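import Mathlib
import HarnessLib
import Literature.NumberTheory.Sieve.BatemanHorn

/-!
# The wide far moment from a TWO-REGIME tail profile (weaker than Poisson local laws)

Crux stmt-Parity-11291 (`Summit.Parity.BatemanHorn.Theses.AlmostPrimeZeros.SystemZeroRepulsion`), far leaf
`FarMomentWide` (stmt-Parity-17115), registered open stub `stub_farMomentWide_beyond_growing` of the line
`smooth-rough-lattice-acquisition` (skeleton v5, lead c3).  Notation: `s_f(n) = Σ_i Σ_{p^v ∥ f_i(n)⁺} min(v,2)`,
`N(m) = #{0 ≤ n ≤ x : s_f(n) = m}`, `L = log log x`.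

The landed bridge `…BuchstabFlowHyperbolicity.farMomentWide_of_localLaws` (p99441) derives the far moment
`Σ_{n≤x} t^{s_f(n)} ≤ (x+1)·exp(C(tL + t²/L))` from Poisson local laws `N(m) ≤ C(x+1)(CL)^m/m!` at ALL levels `m`.
That hypothesis is stronger than the far leaf needs: the budget `exp(C·t²/L)` is generated exactly by the profile
`(C/L)^{⌊m/2⌋}/⌊m/2⌋!` (each further unit of `s` costs only `≍ √(mL/C)`), which beyond `m ≍ L³` is much weaker than
Poisson.  This file proves the sharper sufficiency, with no new definition (the profile is an antecedent, per system):

  `N(m) ≤ C(x+1)·((CL)^m/m! + (C/L)^{⌊m/2⌋}/⌊m/2⌋!)` for all `x ≥ 3`, `m ≥ 0`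
  `⟹ Σ_{n≤x} t^{s_f(n)} ≤ (x+1)·exp(C'(tL + t²/L))` for all `x ≥ 3`, `t ≥ 1` (`C' = 3·max(|C|,1)/2 + 5/2`).

Proof: sum the two exponential series (`Real.sum_le_exp_of_nonneg`), `t^m ≤ (1+t)(t²)^{⌊m/2⌋}`, each `j` is `⌊m/2⌋`
for at most two `m`, and absorb `max(|C|,1)·(3+2t)` into the budget via `tL + t²/L ≥ 2t` (`L > 0` for `x ≥ 3`).
The window `t ≤ √log x` is not used.  (Lead c3 memo `far-leaf-tail-profile-c3.md`, §1: conversely the far moment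
forces `N(m) ≤ (x+1)·inf_t e^{C(tL+t²/L)} t^{−m}`, whose evaluation is this profile up to `e^{O(m)}` — so the profile
is the far leaf's exact content.)
-/

namespace Summit.Parity.BatemanHorn.Cruxes.SystemZeroRepulsion.NearFar

open Finset Real

/-- `0 < log log x` for `x ≥ 3` (as `e < 3`). [folklore] -/
private theorem loglog_pos_of_three_le' {x : ℕ} (hx : 3 ≤ x) : 0 < Real.log (Real.log (x : ℝ)) := by
  have hx3 : (3 : ℝ) ≤ x := by exact_mod_cast hx
  apply Real.log_pos
  rw [Real.lt_log_iff_exp_lt (by linarith)]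
  exact Real.exp_one_lt_d9.trans_le (by norm_num; linarith)

/-- `2t ≤ tL + t²/L` for `L > 0`, `t ≥ 1`. [folklore] -/
private theorem two_mul_le_farBudget' {t L : ℝ} (ht : 1 ≤ t) (hL : 0 < L) : 2 * t ≤ t * L + t ^ 2 / L := by
  have hA : 0 ≤ t * ((L - 1) ^ 2 / L) := mul_nonneg (by linarith) (div_nonneg (sq_nonneg _) hL.le)
  have hB : 0 ≤ (t - 1) * t / L := div_nonneg (mul_nonneg (by linarith) (by linarith)) hL.le
  have h1 : t * L + t ^ 2 / L - 2 * t = t * ((L - 1) ^ 2 / L) + (t - 1) * t / L := by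
    field_simp
    ring
  linarith

/-- Each `j` is `⌊m/2⌋` for exactly the two values `m = 2j, 2j+1`: `Σ_{m<2M} g(⌊m/2⌋) = 2·Σ_{j<M} g(j)`. [folklore] -/
private theorem sum_range_two_mul_comp_div_two (g : ℕ → ℝ) (M : ℕ) :
    ∑ m ∈ Finset.range (2 * M), g (m / 2) = 2 * ∑ j ∈ Finset.range M, g j := by
  induction M with
  | zero => simp
  | succ M ih =>
      rw [show 2 * (M + 1) = 2 * M + 1 + 1 by ring, Finset.sum_range_succ, Finset.sum_range_succ, ih,
        Finset.sum_range_succ]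
      have h1 : (2 * M) / 2 = M := by omega
      have h2 : (2 * M + 1) / 2 = M := by omega
      rw [h1, h2]
      ring

/-- For nonnegative `g`: `Σ_{m<N} g(⌊m/2⌋) ≤ 2·Σ_{j<N/2+1} g(j)`. [folklore] -/
private theorem sum_range_comp_div_two_le (g : ℕ → ℝ) (hg : ∀ j, 0 ≤ g j) (N : ℕ) :
    ∑ m ∈ Finset.range N, g (m / 2) ≤ 2 * ∑ j ∈ Finset.range (N / 2 + 1), g j := by
  rw [← sum_range_two_mul_comp_div_two g (N / 2 + 1)]
  refine Finset.sum_le_sum_of_subset_of_nonneg (Finset.range_subset_range.2 (by omega)) fun m _ _ => hg _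

/-- `t^m ≤ (1 + t)·(t²)^{⌊m/2⌋}` for `t ≥ 0`. [folklore] -/
private theorem pow_le_one_add_mul_sq_pow {t : ℝ} (ht : 0 ≤ t) (m : ℕ) :
    t ^ m ≤ (1 + t) * (t ^ 2) ^ (m / 2) := by
  have hm : m = 2 * (m / 2) + m % 2 := (Nat.div_add_mod m 2).symm
  have hsq : 0 ≤ (t ^ 2) ^ (m / 2) := by positivity
  conv_lhs => rw [hm, pow_add, pow_mul]
  rw [mul_comm]
  refine mul_le_mul_of_nonneg_right ?_ hsq
  rcases Nat.mod_two_eq_zero_or_one m with h | h <;> rw [h]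
  · simp only [pow_zero]; linarith
  · rw [pow_one]; linarith

/-- Summing a two-regime tail profile: if every fibre `{n ∈ S : s n = m}` has at most
`K·(a^m/m! + b^{⌊m/2⌋}/⌊m/2⌋!)` elements (`K, a, b ≥ 0`), then for every `t ≥ 0`
`Σ_{n∈S} t^{s n} ≤ K·(exp(a t) + 2(1+t)·exp(b t²))`. [folklore] -/
private theorem sum_pow_le_of_tailProfile {S : Finset ℕ} (s : ℕ → ℕ) {K a b t : ℝ} (hK : 0 ≤ K)
    (ha : 0 ≤ a) (hb : 0 ≤ b) (ht : 0 ≤ t)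
    (h : ∀ m : ℕ, (((S.filter fun n => s n = m).card : ℕ) : ℝ) ≤
      K * (a ^ m / (m.factorial : ℝ) + b ^ (m / 2) / ((m / 2).factorial : ℝ))) :
    ∑ n ∈ S, t ^ (s n) ≤ K * (Real.exp (a * t) + 2 * (1 + t) * Real.exp (b * t ^ 2)) := by
  classical
  set g : ℕ → ℝ := fun j => (b * t ^ 2) ^ j / (j.factorial : ℝ) with hg
  have hg0 : ∀ j, 0 ≤ g j := fun j => by positivity
  have hterm : ∀ m ∈ S.image s,
      ((S.filter fun n => s n = m).card) • (t ^ m) ≤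
        K * ((a * t) ^ m / (m.factorial : ℝ)) + K * ((1 + t) * g (m / 2)) := by
    intro m _
    rw [nsmul_eq_mul]
    have h1 : (((S.filter fun n => s n = m).card : ℕ) : ℝ) * t ^ m ≤
        K * (a ^ m / (m.factorial : ℝ) + b ^ (m / 2) / ((m / 2).factorial : ℝ)) * t ^ m :=
      mul_le_mul_of_nonneg_right (h m) (pow_nonneg ht _)
    have h2 : b ^ (m / 2) / ((m / 2).factorial : ℝ) * t ^ m ≤ (1 + t) * g (m / 2) := by
      calc b ^ (m / 2) / ((m / 2).factorial : ℝ) * t ^ m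
          ≤ b ^ (m / 2) / ((m / 2).factorial : ℝ) * ((1 + t) * (t ^ 2) ^ (m / 2)) :=
            mul_le_mul_of_nonneg_left (pow_le_one_add_mul_sq_pow ht m) (by positivity)
        _ = (1 + t) * g (m / 2) := by
            simp only [hg, mul_pow]; ring
    have h3 : K * (a ^ m / (m.factorial : ℝ) + b ^ (m / 2) / ((m / 2).factorial : ℝ)) * t ^ m =
        K * ((a * t) ^ m / (m.factorial : ℝ)) + K * (b ^ (m / 2) / ((m / 2).factorial : ℝ) * t ^ m) := by
      rw [mul_pow]; ring
    rw [h3] at h1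
    have h4 : K * (b ^ (m / 2) / ((m / 2).factorial : ℝ) * t ^ m) ≤ K * ((1 + t) * g (m / 2)) :=
      mul_le_mul_of_nonneg_left h2 hK
    linarith
  set N : ℕ := (S.image s).sup id + 1 with hN
  have hsub : S.image s ⊆ Finset.range N := by
    intro m hm
    have hle : m ≤ (S.image s).sup id := Finset.le_sup (f := id) hm
    exact Finset.mem_range.mpr (by omega)
  have hat : 0 ≤ a * t := mul_nonneg ha ht
  have hbt : 0 ≤ b * t ^ 2 := by positivity
  calc ∑ n ∈ S, t ^ (s n)
      = ∑ m ∈ S.image s, ((S.filter fun n => s n = m).card) • (t ^ m) :=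
        Finset.sum_comp (fun m => t ^ m) s
    _ ≤ ∑ m ∈ S.image s, (K * ((a * t) ^ m / (m.factorial : ℝ)) + K * ((1 + t) * g (m / 2))) :=
        Finset.sum_le_sum hterm
    _ ≤ ∑ m ∈ Finset.range N, (K * ((a * t) ^ m / (m.factorial : ℝ)) + K * ((1 + t) * g (m / 2))) := by
        refine Finset.sum_le_sum_of_subset_of_nonneg hsub fun m _ _ => ?_
        have := hg0 (m / 2)
        positivity
    _ = K * ∑ m ∈ Finset.range N, (a * t) ^ m / (m.factorial : ℝ) +
          K * (1 + t) * ∑ m ∈ Finset.range N, g (m / 2) := by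
        rw [Finset.sum_add_distrib, ← Finset.mul_sum, ← Finset.mul_sum, ← Finset.mul_sum]; ring
    _ ≤ K * Real.exp (a * t) + K * (1 + t) * (2 * ∑ j ∈ Finset.range (N / 2 + 1), g j) := by
        gcongr
        · exact Real.sum_le_exp_of_nonneg hat N
        · exact sum_range_comp_div_two_le g hg0 N
    _ ≤ K * Real.exp (a * t) + K * (1 + t) * (2 * Real.exp (b * t ^ 2)) := by
        gcongr
        exact Real.sum_le_exp_of_nonneg hbt _
    _ = K * (Real.exp (a * t) + 2 * (1 + t) * Real.exp (b * t ^ 2)) := by ring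

/-- **The wide far moment from a two-regime tail profile.**  For every `k, f` (in particular every
Bateman–Horn system): if `#{n ≤ x : s_f(n) = m} ≤ C(x+1)·((C log log x)^m/m! + (C/log log x)^{⌊m/2⌋}/⌊m/2⌋!)` for all
`x ≥ 3` and all `m`, then `Σ_{n≤x} t^{s_f(n)} ≤ (x+1)·exp(C'(t log log x + t²/log log x))` for all `x ≥ 3` and ALL
`t ≥ 1` (so in particular on the far leaf's window `1 ≤ t ≤ √log x`), with `C' = 3·max(|C|,1)/2 + 5/2`.  Weaker
hypothesis than the Poisson local laws of `farMomentWide_of_localLaws` (p99441) beyond `m ≍ (log log x)³`. [folklore] -/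
theorem farMomentWide_of_tailProfile :
    ∀ (k : ℕ) (f : Fin k → Polynomial ℤ), Literature.NumberTheory.Sieve.IsBatemanHornSystem f →
      (∃ C : ℝ, ∀ x : ℕ, 3 ≤ x → ∀ m : ℕ,
        ((((Finset.range (x + 1)).filter fun n : ℕ =>
            (∑ i, (((f i).eval (n : ℤ)).toNat.factorization.sum fun _ v => min v 2)) = m).card : ℕ) : ℝ) ≤
          C * ((x : ℝ) + 1) *
            ((C * Real.log (Real.log (x : ℝ))) ^ m / (m.factorial : ℝ) +
              (C / Real.log (Real.log (x : ℝ))) ^ (m / 2) / ((m / 2).factorial : ℝ))) →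
      ∃ C : ℝ, ∀ x : ℕ, 3 ≤ x → ∀ t : ℝ, 1 ≤ t → t ≤ Real.sqrt (Real.log (x : ℝ)) →
        (∑ n ∈ Finset.range (x + 1),
            (t : ℝ) ^ (∑ i, (((f i).eval (n : ℤ)).toNat.factorization.sum fun _ v => min v 2))) ≤
          ((x : ℝ) + 1) *
            Real.exp (C * (t * Real.log (Real.log (x : ℝ)) + t ^ 2 / Real.log (Real.log (x : ℝ)))) := by
  intro k f _ hTP
  obtain ⟨C, hC⟩ := hTP
  set s : ℕ → ℕ :=
    (fun n : ℕ => ∑ i, (((f i).eval (n : ℤ)).toNat.factorization.sum fun _ v => min v 2)) with hs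
  set C' : ℝ := max |C| 1 with hC'
  have hC'1 : 1 ≤ C' := le_max_right _ _
  have hC'0 : 0 ≤ C' := by linarith
  have hCC' : |C| ≤ C' := le_max_left _ _
  refine ⟨3 * C' / 2 + 5 / 2, fun x hx t ht _ => ?_⟩
  set L : ℝ := Real.log (Real.log (x : ℝ)) with hL
  have hL0 : 0 < L := loglog_pos_of_three_le' hx
  have ht0 : 0 ≤ t := by linarith
  have hx0 : (0 : ℝ) ≤ (x : ℝ) + 1 := by positivity
  have hbud : 2 * t ≤ t * L + t ^ 2 / L := two_mul_le_farBudget' ht hL0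
  -- the profile with the positive constant `C'`
  have hC'm : ∀ m : ℕ,
      ((((Finset.range (x + 1)).filter fun n => s n = m).card : ℕ) : ℝ) ≤
        (C' * ((x : ℝ) + 1)) * ((C' * L) ^ m / (m.factorial : ℝ) + (C' / L) ^ (m / 2) / ((m / 2).factorial : ℝ)) := by
    intro m
    have h1 := hC x hx m
    have hA : (|C| * L) ^ m ≤ (C' * L) ^ m :=
      pow_le_pow_left₀ (by positivity) (mul_le_mul_of_nonneg_right hCC' hL0.le) m
    have hB : (|C| / L) ^ (m / 2) ≤ (C' / L) ^ (m / 2) :=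
      pow_le_pow_left₀ (by positivity) (div_le_div_of_nonneg_right hCC' hL0.le) _
    have h3 : |C| * ((x : ℝ) + 1) ≤ C' * ((x : ℝ) + 1) := mul_le_mul_of_nonneg_right hCC' hx0
    have h4 : |C| * ((x : ℝ) + 1) * ((|C| * L) ^ m / (m.factorial : ℝ) + (|C| / L) ^ (m / 2) / ((m / 2).factorial : ℝ)) ≤
        C' * ((x : ℝ) + 1) * ((C' * L) ^ m / (m.factorial : ℝ) + (C' / L) ^ (m / 2) / ((m / 2).factorial : ℝ)) := by
      apply mul_le_mul h3 _ (by positivity) (by positivity)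
      gcongr
    calc ((((Finset.range (x + 1)).filter fun n => s n = m).card : ℕ) : ℝ)
        ≤ C * ((x : ℝ) + 1) * ((C * L) ^ m / (m.factorial : ℝ) + (C / L) ^ (m / 2) / ((m / 2).factorial : ℝ)) := h1
      _ ≤ |C * ((x : ℝ) + 1) * ((C * L) ^ m / (m.factorial : ℝ) + (C / L) ^ (m / 2) / ((m / 2).factorial : ℝ))| :=
          le_abs_self _
      _ ≤ |C| * ((x : ℝ) + 1) * ((|C| * L) ^ m / (m.factorial : ℝ) + (|C| / L) ^ (m / 2) / ((m / 2).factorial : ℝ)) := by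
          rw [abs_mul, abs_mul, abs_of_nonneg hx0]
          refine mul_le_mul_of_nonneg_left ?_ (by positivity)
          calc |(C * L) ^ m / (m.factorial : ℝ) + (C / L) ^ (m / 2) / ((m / 2).factorial : ℝ)|
              ≤ |(C * L) ^ m / (m.factorial : ℝ)| + |(C / L) ^ (m / 2) / ((m / 2).factorial : ℝ)| := abs_add_le _ _
            _ = (|C| * L) ^ m / (m.factorial : ℝ) + (|C| / L) ^ (m / 2) / ((m / 2).factorial : ℝ) := by
                rw [abs_div, abs_div, abs_pow, abs_pow, abs_mul, abs_div, abs_of_nonneg hL0.le,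
                  Nat.abs_cast, Nat.abs_cast]
      _ ≤ _ := h4
  -- sum the two series
  have hsum := sum_pow_le_of_tailProfile s (by positivity : 0 ≤ C' * ((x : ℝ) + 1)) (by positivity)
    (by positivity) ht0 hC'm
  -- absorb everything into the budget `B := tL + t²/L ≥ 2t ≥ 2`
  set B : ℝ := t * L + t ^ 2 / L with hBdef
  have hB2t : 2 * t ≤ B := hbud
  have hexp1 : Real.exp (C' * L * t) ≤ Real.exp (C' * B) := by
    apply Real.exp_le_exp.2
    have : 0 ≤ t ^ 2 / L := by positivity
    nlinarith
  have hexp2 : Real.exp (C' / L * t ^ 2) ≤ Real.exp (C' * B) := by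
    apply Real.exp_le_exp.2
    have h1 : C' / L * t ^ 2 = C' * (t ^ 2 / L) := by ring
    have h2 : 0 ≤ t * L := by positivity
    nlinarith
  -- `C'(3 + 2t) ≤ exp(C') · exp(5t) ≤ exp((C'/2 + 5/2)·B)`
  have h32 : C' * (3 + 2 * t) ≤ Real.exp ((C' / 2 + 5 / 2) * B) := by
    have e1 : C' ≤ Real.exp C' := by linarith [Real.add_one_le_exp C']
    have e2 : 3 + 2 * t ≤ Real.exp (5 * t) := by nlinarith [Real.add_one_le_exp (5 * t)]
    calc C' * (3 + 2 * t) ≤ Real.exp C' * Real.exp (5 * t) :=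
          mul_le_mul e1 e2 (by linarith) (Real.exp_pos _).le
      _ = Real.exp (C' + 5 * t) := (Real.exp_add _ _).symm
      _ ≤ Real.exp ((C' / 2 + 5 / 2) * B) := Real.exp_le_exp.2 (by nlinarith)
  calc ∑ n ∈ Finset.range (x + 1), t ^ (s n)
      ≤ C' * ((x : ℝ) + 1) * (Real.exp (C' * L * t) + 2 * (1 + t) * Real.exp (C' / L * t ^ 2)) := hsum
    _ ≤ C' * ((x : ℝ) + 1) * (Real.exp (C' * B) + 2 * (1 + t) * Real.exp (C' * B)) := by
        gcongr
    _ = ((x : ℝ) + 1) * ((C' * (3 + 2 * t)) * Real.exp (C' * B)) := by ring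
    _ ≤ ((x : ℝ) + 1) * (Real.exp ((C' / 2 + 5 / 2) * B) * Real.exp (C' * B)) := by
        gcongr
    _ = ((x : ℝ) + 1) * Real.exp ((3 * C' / 2 + 5 / 2) * B) := by
        rw [← Real.exp_add]; ring_nf

end Summit.Parity.BatemanHorn.Cruxes.SystemZeroRepulsion.NearFar
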